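import Mathlib
import Literature.Analysis.FunctionSpaces.BesselKConnection
import Literature.Analysis.FunctionSpaces.BesselIDerivative
import Literature.Analysis.FunctionSpaces.BesselIRecurrence
import Literature.Analysis.FunctionSpaces.BesselIIntegralSeries
import HarnessLib

/-!
# `I_n` and `K_ν` on the positive real axis: signs of the derivatives and the modified Bessel
# equation in `θ`-form, for the tree's REAL functions `besselI` / `besselKReal`

Topic `Literature/Analysis/FunctionSpaces`, a proofs-only sibling of `BesselMoments.lean`
(`besselI n x`, `besselKReal ν x`), `BesselIDerivative.lean` / `BesselIRecurrence.lean`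
(`I₀' = I₁`, `I_{n+1}' = (I_n + I_{n+2})/2`, `x(I_n − I_{n+2}) = 2(n+1)I_{n+1}`, DLMF 10.29.1) and
`BesselKConnection.lean` (the complex `K_ν`: `hasDerivAt_besselK_ofReal`, `besselKTheta_eq`,
`hasDerivAt_besselKTheta`).  Everything here is PROVED; no definition, no named fact.  Written because
a consumer (the vacuum/wall factor `Λ` of the screw pinch, `Literature/MathematicalPhysics/MHD/`,
Freidberg *Ideal MHD* (11.96)) needs, for the REAL functions of a real variable:

* `besselI_pos_of_pos` — `I_n(x) > 0` (`x > 0`), transported from the series-defined twin;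
* `mul_deriv_besselI`, `mul_deriv_besselI_succ` — the two `θ`-recurrences
  `x I_n' = n I_n + x I_{n+1}` and `x I_{n+1}' = x I_n − (n+1) I_{n+1}` [DLMF 10.29.2];
* `deriv_besselI_pos` — `I_n'(x) > 0` for `x > 0`;
* `hasDerivAt_mul_deriv_besselI` — **the modified Bessel equation in `θ`-form**,
  `(x I_n')' = (x + n²/x) I_n` (`x ≠ 0`) [DLMF 10.25.1];
* `hasDerivAt_besselKReal`, `deriv_besselKReal_eq` — `K_ν'(x) = −(K_{ν+1}(x) + K_{ν−1}(x))/2` for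
  real `ν` and `x > 0` [DLMF 10.29.1; Watson §3.71 (4)], hence `deriv_besselKReal_neg` — `K_ν' < 0`;
* `hasDerivAt_mul_deriv_besselKReal` — `(x K_ν')' = (x + ν²/x) K_ν` (`x > 0`) [DLMF 10.25.1].

## References
* [DLMF] NIST Digital Library of Mathematical Functions §10.25 (eq. 10.25.1, the modified Bessel
  equation), §10.29 (10.29.1–10.29.2, recurrences and derivatives).
* [Watson1944] G. N. Watson, *A Treatise on the Theory of Bessel Functions*, §3.71 (4).
-/

noncomputable section

namespace Literature.Analysis.FunctionSpaces

open Real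

/-! ## `I_n` on `(0, ∞)` -/

/-- `I_n(x) > 0` for `x > 0` and every `n ∈ ℕ` (every term of the power series DLMF 10.25.2 is
positive; transported from `Literature.Probability.LatticeModels.besselI_pos` through
`besselI_eq_latticeModels_besselI`). [cite: DLMF, 10.25.2] -/
theorem besselI_pos_of_pos (n : ℕ) {x : ℝ} (hx : 0 < x) : 0 < besselI n x := by
  rw [besselI_eq_latticeModels_besselI]
  exact Probability.LatticeModels.besselI_pos hx _

/-- The `θ`-recurrence `x I_n'(x) = n I_n(x) + x I_{n+1}(x)` (all real `x`, `n ∈ ℕ`; at `n = 0` it is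
`I₀' = I₁`). [cite: DLMF, 10.29.2] -/
theorem mul_deriv_besselI (n : ℕ) (x : ℝ) :
    x * deriv (besselI n) x = n * besselI n x + x * besselI (n + 1) x := by
  rcases n with _ | k
  · rw [deriv_besselI_zero]
    simp
  · rw [deriv_besselI_succ]
    have h := mul_besselI_sub_besselI_add_two k x
    push_cast
    linear_combination (1 / 2 : ℝ) * h

/-- The companion `θ`-recurrence `x I_{n+1}'(x) = x I_n(x) − (n+1) I_{n+1}(x)` (all real `x`).
[cite: DLMF, 10.29.2] -/
theorem mul_deriv_besselI_succ (n : ℕ) (x : ℝ) :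
    x * deriv (besselI (n + 1)) x = x * besselI n x - (n + 1) * besselI (n + 1) x := by
  rw [deriv_besselI_succ]
  have h := mul_besselI_sub_besselI_add_two n x
  linear_combination (-1 / 2 : ℝ) * h

/-- `I_n'(x) > 0` for `x > 0` (`I₀' = I₁ > 0`, `I_{n+1}' = (I_n + I_{n+2})/2 > 0`).
[cite: DLMF, 10.29.1] -/
theorem deriv_besselI_pos (n : ℕ) {x : ℝ} (hx : 0 < x) : 0 < deriv (besselI n) x := by
  rcases n with _ | k
  · rw [deriv_besselI_zero]
    exact besselI_pos_of_pos 1 hx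
  · rw [deriv_besselI_succ]
    have h1 := besselI_pos_of_pos k hx
    have h2 := besselI_pos_of_pos (k + 2) hx
    linarith

/-- `I_n` is strictly increasing on `[0, ∞)`. [cite: DLMF, 10.29.1] -/
theorem strictMonoOn_besselI (n : ℕ) : StrictMonoOn (besselI n) (Set.Ici 0) := by
  refine strictMonoOn_of_deriv_pos (convex_Ici 0) (differentiable_besselI n).continuous.continuousOn ?_
  intro x hx
  rw [interior_Ici] at hx
  exact deriv_besselI_pos n hx

/-- **The modified Bessel equation for `I_n` in `θ`-form**: `(x I_n'(x))' = (x + n²/x) I_n(x)` for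
`x ≠ 0`, i.e. `x² I_n'' + x I_n' − (x² + n²) I_n = 0`. [cite: DLMF, 10.25.1] -/
theorem hasDerivAt_mul_deriv_besselI (n : ℕ) {x : ℝ} (hx : x ≠ 0) :
    HasDerivAt (fun y => y * deriv (besselI n) y) ((x + (n : ℝ) ^ 2 / x) * besselI n x) x := by
  have hfun : (fun y => y * deriv (besselI n) y) = fun y => (n : ℝ) * besselI n y + y * besselI (n + 1) y :=
    funext (mul_deriv_besselI n)
  rw [hfun]
  have h1 : HasDerivAt (besselI n) (deriv (besselI n) x) x := (differentiable_besselI n x).hasDerivAt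
  have h2 : HasDerivAt (besselI (n + 1)) (deriv (besselI (n + 1)) x) x :=
    (differentiable_besselI (n + 1) x).hasDerivAt
  have h := (h1.const_mul (n : ℝ)).add ((hasDerivAt_id x).mul h2)
  refine h.congr_deriv ?_
  have r1 := mul_deriv_besselI n x
  have r2 := mul_deriv_besselI_succ n x
  -- `n I_n' + I_{n+1} + x I_{n+1}' = (x + n²/x) I_n`
  have e1 : deriv (besselI n) x = ((n : ℝ) * besselI n x + x * besselI (n + 1) x) / x := by
    rw [eq_div_iff hx]; linarith [r1]
  have e2 : deriv (besselI (n + 1)) x = (x * besselI n x - (n + 1) * besselI (n + 1) x) / x := by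
    rw [eq_div_iff hx]; linarith [r2]
  rw [e1, e2]
  simp only [id]
  field_simp
  ring

/-! ## `K_ν` on `(0, ∞)` (real order) -/

/-- **`K_ν'(x) = −(K_{ν+1}(x) + K_{ν−1}(x))/2`** for real `ν` and `x > 0`, for the tree's real
`besselKReal` (from the complex statement `besselKTheta_eq`: `θK_ν = −(x/2)(K_{ν+1} + K_{ν−1})`).
[cite: DLMF, 10.29.1] (Watson1944 §3.71 (4)) -/
theorem hasDerivAt_besselKReal (ν : ℝ) {x : ℝ} (hx : 0 < x) :
    HasDerivAt (besselKReal ν) (-(besselKReal (ν + 1) x + besselKReal (ν - 1) x) / 2) x := by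
  have hC := hasDerivAt_besselK_ofReal (ν : ℂ) hx
  have hre := (Complex.reCLM.hasFDerivAt.comp_hasDerivAt x hC)
  have hfun : ((Complex.reCLM : ℂ →L[ℝ] ℝ) ∘ fun y : ℝ => besselK (ν : ℂ) (y : ℂ)) = besselKReal ν := by
    funext y
    simp only [Function.comp_apply, Complex.reCLM_apply]
    rw [← ofReal_besselKReal, Complex.ofReal_re]
  rw [hfun] at hre
  refine hre.congr_deriv ?_
  rw [Complex.reCLM_apply, besselKTheta_eq _ hx]
  have e1 : besselK ((ν : ℂ) + 1) (x : ℂ) = (besselKReal (ν + 1) x : ℂ) := by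
    rw [ofReal_besselKReal]; push_cast; rfl
  have e2 : besselK ((ν : ℂ) - 1) (x : ℂ) = (besselKReal (ν - 1) x : ℂ) := by
    rw [ofReal_besselKReal]; push_cast; rfl
  rw [e1, e2]
  have hx0 : (x : ℂ) ≠ 0 := by exact_mod_cast hx.ne'
  have : -((x : ℂ) / 2) * ((besselKReal (ν + 1) x : ℂ) + (besselKReal (ν - 1) x : ℂ)) / (x : ℂ)
      = ((-(besselKReal (ν + 1) x + besselKReal (ν - 1) x) / 2 : ℝ) : ℂ) := by
    push_cast
    field_simp
  rw [this, Complex.ofReal_re]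

/-- `deriv K_ν(x) = −(K_{ν+1}(x) + K_{ν−1}(x))/2` (`ν` real, `x > 0`). [cite: DLMF, 10.29.1] -/
theorem deriv_besselKReal_eq (ν : ℝ) {x : ℝ} (hx : 0 < x) :
    deriv (besselKReal ν) x = -(besselKReal (ν + 1) x + besselKReal (ν - 1) x) / 2 :=
  (hasDerivAt_besselKReal ν hx).deriv

/-- **`K_ν'(x) < 0`** for real `ν` and `x > 0` (`K_{ν±1}(x) > 0`). [cite: DLMF, 10.29.1] -/
theorem deriv_besselKReal_neg (ν : ℝ) {x : ℝ} (hx : 0 < x) : deriv (besselKReal ν) x < 0 := by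
  rw [deriv_besselKReal_eq ν hx]
  have h1 := besselKReal_pos (ν + 1) hx
  have h2 := besselKReal_pos (ν - 1) hx
  linarith

/-- `K_ν` is differentiable at every `x > 0`. [cite: DLMF, 10.29.1] -/
theorem differentiableAt_besselKReal (ν : ℝ) {x : ℝ} (hx : 0 < x) :
    DifferentiableAt ℝ (besselKReal ν) x :=
  (hasDerivAt_besselKReal ν hx).differentiableAt

/-- `K_ν` is continuous on `(0, ∞)`. [cite: DLMF, 10.29.1] -/
theorem continuousOn_besselKReal (ν : ℝ) : ContinuousOn (besselKReal ν) (Set.Ioi 0) :=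
  fun _ hx => (differentiableAt_besselKReal ν hx).continuousAt.continuousWithinAt

/-- `K_ν` is strictly decreasing on `(0, ∞)`. [cite: DLMF, 10.29.1] -/
theorem strictAntiOn_besselKReal (ν : ℝ) : StrictAntiOn (besselKReal ν) (Set.Ioi 0) := by
  refine strictAntiOn_of_deriv_neg (convex_Ioi 0) (continuousOn_besselKReal ν) ?_
  intro x hx
  rw [interior_Ioi] at hx
  exact deriv_besselKReal_neg ν hx

/-- The real `θK_ν`: for `x > 0`, `Re θK_ν(x) = x · K_ν'(x)` with the real derivative
`K_ν' = −(K_{ν+1} + K_{ν−1})/2`. [cite: DLMF, 10.29.1] -/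
theorem besselKTheta_re_eq (ν : ℝ) {x : ℝ} (hx : 0 < x) :
    (besselKTheta ν x).re = x * deriv (besselKReal ν) x := by
  rw [besselKTheta_eq _ hx, deriv_besselKReal_eq ν hx]
  have e1 : besselK ((ν : ℂ) + 1) (x : ℂ) = (besselKReal (ν + 1) x : ℂ) := by
    rw [ofReal_besselKReal]; push_cast; rfl
  have e2 : besselK ((ν : ℂ) - 1) (x : ℂ) = (besselKReal (ν - 1) x : ℂ) := by
    rw [ofReal_besselKReal]; push_cast; rfl
  rw [e1, e2]
  have : -((x : ℂ) / 2) * ((besselKReal (ν + 1) x : ℂ) + (besselKReal (ν - 1) x : ℂ))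
      = ((x * (-(besselKReal (ν + 1) x + besselKReal (ν - 1) x) / 2) : ℝ) : ℂ) := by
    push_cast
    ring
  rw [this, Complex.ofReal_re]

/-- **The modified Bessel equation for `K_ν` in `θ`-form** on the real axis:
`(x K_ν'(x))' = (x + ν²/x) K_ν(x)` for real `ν` and `x > 0` (real part of `hasDerivAt_besselKTheta`).
[cite: DLMF, 10.25.1] (Watson1944 §3.7 (1)) -/
theorem hasDerivAt_mul_deriv_besselKReal (ν : ℝ) {x : ℝ} (hx : 0 < x) :
    HasDerivAt (fun y => y * deriv (besselKReal ν) y) ((x + ν ^ 2 / x) * besselKReal ν x) x := by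
  have hθ := hasDerivAt_besselKTheta (ν : ℂ) hx
  have hre := (Complex.reCLM.hasFDerivAt.comp_hasDerivAt x hθ)
  have hev : (fun y : ℝ => y * deriv (besselKReal ν) y)
      =ᶠ[nhds x] ((Complex.reCLM : ℂ →L[ℝ] ℝ) ∘ besselKTheta (ν : ℂ)) := by
    filter_upwards [Ioi_mem_nhds hx] with y hy
    simp only [Function.comp_apply, Complex.reCLM_apply]
    exact (besselKTheta_re_eq ν hy).symm
  refine (hre.congr_of_eventuallyEq hev).congr_deriv ?_
  rw [Complex.reCLM_apply, ← ofReal_besselKReal]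
  have hx0 : (x : ℂ) ≠ 0 := by exact_mod_cast hx.ne'
  have : (((ν : ℂ)) ^ 2 + (x : ℂ) ^ 2) * (besselKReal ν x : ℂ) / (x : ℂ)
      = (((x + ν ^ 2 / x) * besselKReal ν x : ℝ) : ℂ) := by
    push_cast
    field_simp
    ring
  rw [this, Complex.ofReal_re]


/-! ## `I_n(x) ≤ cosh x` (appended 2026-08-27, g6) -/

/-- **`I_0(x) ≤ cosh x`** for every real `x`: symmetrising the integral (10.32.1) under `θ ↦ π − θ` gives
`I_0(x) = π⁻¹ ∫₀^π cosh(x cos θ) dθ`, and `cosh(x cos θ) ≤ cosh x`.  (The upper enclosure of `I_0` — hence of every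
`I_n ≤ I_0`, `besselI_le_cosh` — used by the MHD wall-factor brackets at small argument.) [cite: DLMF, 10.32.1] -/
theorem besselI_zero_le_cosh (x : ℝ) : besselI 0 x ≤ Real.cosh x := by
  rw [besselI_zero_eq]
  set J : ℝ := ∫ θ in (0 : ℝ)..π, Real.exp (x * Real.cos θ) with hJ
  -- reflection `θ ↦ π − θ`
  have hrefl : ∫ θ in (0 : ℝ)..π, Real.exp (x * Real.cos (π - θ)) = J := by
    have h := intervalIntegral.integral_comp_sub_left (fun θ => Real.exp (x * Real.cos θ)) (a := 0) (b := π) π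
    simp only [sub_self, sub_zero] at h
    rw [h]
  have hrefl' : ∫ θ in (0 : ℝ)..π, Real.exp (-(x * Real.cos θ)) = J := by
    rw [← hrefl]
    refine intervalIntegral.integral_congr fun θ _ => ?_
    simp only [Real.cos_pi_sub, mul_neg]
  -- `2J = ∫ 2 cosh(x cos θ) ≤ 2π cosh x`
  have hc1 : IntervalIntegrable (fun θ => Real.exp (x * Real.cos θ)) MeasureTheory.volume 0 π :=
    (by fun_prop : Continuous fun θ => Real.exp (x * Real.cos θ)).intervalIntegrable _ _
  have hc2 : IntervalIntegrable (fun θ => Real.exp (-(x * Real.cos θ))) MeasureTheory.volume 0 π :=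
    (by fun_prop : Continuous fun θ => Real.exp (-(x * Real.cos θ))).intervalIntegrable _ _
  have h2J : 2 * J = ∫ θ in (0 : ℝ)..π, 2 * Real.cosh (x * Real.cos θ) := by
    rw [two_mul, show J + J = J + ∫ θ in (0 : ℝ)..π, Real.exp (-(x * Real.cos θ)) by rw [hrefl'], hJ,
      ← intervalIntegral.integral_add hc1 hc2]
    refine intervalIntegral.integral_congr fun θ _ => ?_
    simp only [Real.cosh_eq]
    ring
  have hle : ∫ θ in (0 : ℝ)..π, 2 * Real.cosh (x * Real.cos θ) ≤ ∫ θ in (0 : ℝ)..π, 2 * Real.cosh x := by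
    refine intervalIntegral.integral_mono_on Real.pi_pos.le ?_ ?_ fun θ _ => ?_
    · exact (by fun_prop : Continuous fun θ => 2 * Real.cosh (x * Real.cos θ)).intervalIntegrable _ _
    · exact intervalIntegrable_const
    · have : Real.cosh (x * Real.cos θ) ≤ Real.cosh x := by
        rw [Real.cosh_le_cosh, abs_mul]
        exact mul_le_of_le_one_right (abs_nonneg x) (Real.abs_cos_le_one θ)
      linarith
  rw [intervalIntegral.integral_const, sub_zero, smul_eq_mul] at hle
  have hπ := Real.pi_pos
  rw [inv_mul_le_iff₀ hπ]
  nlinarith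

/-- `I_n(x) ≤ cosh x` for `x ≥ 0` (`I_n ≤ I_0 ≤ cosh`). [cite: DLMF, 10.32.1] -/
theorem besselI_le_cosh (n : ℕ) {x : ℝ} (hx : 0 ≤ x) : besselI n x ≤ Real.cosh x :=
  (besselI_le_besselI_of_le (Nat.zero_le n) hx).trans (besselI_zero_le_cosh x)


/-! ## Two-sided geometric enclosures of `I_n` from its power series (appended 2026-08-27, g6)

DLMF 10.25.2: `I_n(x) = Σ_k (x/2)^{2k+n}/(k!(k+n)!)`.  The ratio of consecutive terms is
`(x²/4)/((k+1)(k+n+1)) ≤ ρ := x²/(4(n+1))`, so for `x ≥ 0`: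
`(x/2)ⁿ/n! · (1 + ρ) ≤ I_n(x) ≤ (x/2)ⁿ/n! · 1/(1 − ρ)` (`ρ < 1`) — the second term from below, the geometric
majorant from above (relative width `O(ρ²)`; e.g. `x = 3/10`, `n = 2`: `ρ = 3/400`).  These replace the cruder
`I_n ≤ (x/2)ⁿ/n!·cosh x` in the MHD wall-factor brackets. -/

/-- `n!·(n+1)^k ≤ k!·(k+n)!`. [folklore] -/
private theorem factorial_mul_pow_le (n k : ℕ) : n.factorial * (n + 1) ^ k ≤ k.factorial * (k + n).factorial := by
  induction k with
  | zero => simp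
  | succ k ih =>
    have h1 : (k + 1).factorial * (k + 1 + n).factorial = (k + 1) * (k + 1 + n) * (k.factorial * (k + n).factorial) := by
      rw [Nat.factorial_succ, show k + 1 + n = (k + n) + 1 by ring, Nat.factorial_succ]; ring
    rw [h1, pow_succ]
    calc n.factorial * ((n + 1) ^ k * (n + 1)) = (n + 1) * (n.factorial * (n + 1) ^ k) := by ring
      _ ≤ (k + 1) * (k + 1 + n) * (k.factorial * (k + n).factorial) := by
          apply Nat.mul_le_mul _ ih
          nlinarith

/-- The `k`-th series term of `I_n` is at most the first term times `(x²/(4(n+1)))^k` (`x ≥ 0`).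
[cite: DLMF, 10.25.2] -/
theorem besselITerm_le_geometric (n k : ℕ) {x : ℝ} (hx : 0 ≤ x) :
    (x / 2) ^ (2 * k + n) / ((k.factorial : ℝ) * ((k + n).factorial : ℝ))
      ≤ (x / 2) ^ n / (n.factorial : ℝ) * (x ^ 2 / (4 * (n + 1))) ^ k := by
  have hfac := factorial_mul_pow_le n k
  have hfacR : (n.factorial : ℝ) * ((n : ℝ) + 1) ^ k ≤ (k.factorial : ℝ) * ((k + n).factorial : ℝ) := by exact_mod_cast hfac
  have hkpos : (0 : ℝ) < (k.factorial : ℝ) * ((k + n).factorial : ℝ) := by positivity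
  have hnpos : (0 : ℝ) < (n.factorial : ℝ) * ((n : ℝ) + 1) ^ k := by positivity
  have e : (x / 2) ^ n / (n.factorial : ℝ) * (x ^ 2 / (4 * (n + 1))) ^ k
      = (x / 2) ^ (2 * k + n) / ((n.factorial : ℝ) * ((n : ℝ) + 1) ^ k) := by
    have hn1 : ((n : ℝ) + 1) ≠ 0 := by positivity
    have hnf : (n.factorial : ℝ) ≠ 0 := by positivity
    rw [pow_add, pow_mul, show (x / 2) ^ 2 = x ^ 2 / 4 by ring]
    simp only [div_pow, mul_pow]
    have h4k : (4 : ℝ) ^ k ≠ 0 := by positivity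
    have h2n : (2 : ℝ) ^ n ≠ 0 := by positivity
    have hn1k : ((n : ℝ) + 1) ^ k ≠ 0 := by positivity
    field_simp
  rw [e]
  have hnum : 0 ≤ (x / 2) ^ (2 * k + n) := by positivity
  exact div_le_div_of_nonneg_left hnum hnpos hfacR

/-- ★ **`I_n(x) ≤ (x/2)ⁿ/n! · 1/(1 − x²/(4(n+1)))`** for `x ≥ 0` with `x² < 4(n+1)` (geometric majorant of the
series). [cite: DLMF, 10.25.2] -/
theorem besselI_le_firstTerm_div (n : ℕ) {x : ℝ} (hx : 0 ≤ x) (hρ : x ^ 2 < 4 * (n + 1)) :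
    besselI n x ≤ (x / 2) ^ n / (n.factorial : ℝ) * (1 - x ^ 2 / (4 * (n + 1)))⁻¹ := by
  set ρ : ℝ := x ^ 2 / (4 * (n + 1)) with hρdef
  have hρ0 : 0 ≤ ρ := by positivity
  have hρ1 : ρ < 1 := by rw [hρdef, div_lt_one (by positivity)]; linarith
  have hgeom := (hasSum_geometric_of_lt_one hρ0 hρ1).mul_left ((x / 2) ^ n / (n.factorial : ℝ))
  exact hasSum_le (fun k => besselITerm_le_geometric n k hx) (hasSum_besselI n x) hgeom

/-- ★ **`(x/2)ⁿ/n! · (1 + x²/(4(n+1))) ≤ I_n(x)`** for `x ≥ 0` (the first two terms of the positive series).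
[cite: DLMF, 10.25.2] -/
theorem firstTwoTerms_le_besselI (n : ℕ) {x : ℝ} (hx : 0 ≤ x) :
    (x / 2) ^ n / (n.factorial : ℝ) * (1 + x ^ 2 / (4 * (n + 1))) ≤ besselI n x := by
  have h := hasSum_besselI n x
  have hnn : ∀ k ∉ Finset.range 2, 0 ≤ (x / 2) ^ (2 * k + n) / ((k.factorial : ℝ) * ((k + n).factorial : ℝ)) :=
    fun k _ => by positivity
  have h2 := sum_le_hasSum (Finset.range 2) hnn h
  have e : ∑ k ∈ Finset.range 2, (x / 2) ^ (2 * k + n) / ((k.factorial : ℝ) * ((k + n).factorial : ℝ))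
      = (x / 2) ^ n / (n.factorial : ℝ) * (1 + x ^ 2 / (4 * (n + 1))) := by
    rw [Finset.sum_range_succ, Finset.sum_range_succ, Finset.sum_range_zero]
    simp only [Nat.factorial_zero, Nat.cast_one, one_mul, mul_zero, zero_add, mul_one, Nat.factorial_one]
    rw [show 1 + n = n + 1 by ring, Nat.factorial_succ, Nat.cast_mul, pow_add]
    push_cast
    have hn : (n.factorial : ℝ) ≠ 0 := by positivity
    have hn1 : ((n : ℝ) + 1) ≠ 0 := by positivity
    field_simp
    ring
  rw [e] at h2
  exact h2

end Literature.Analysis.FunctionSpaces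

end
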